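import Summits.HodgeConjecture.CorCM.IrreducibleOddWeightsShadowModules
import Summits.HodgeConjecture.CorCM.IrreducibleOddWeightsIndexScaling
import Summits.HodgeConjecture.CorCM.IrreducibleOddWeightsRightIdealsPivot
import HarnessLib

/-!
# Shadow modules, V (CM fields): RATIONAL WITNESSES ARE REALISED — any odd rational weight whose coefficient space meets
# the partner's is, up to an even multiple, the shadow of a CM type of EVERY field of large even index over the pivot;
# an equivariant map carrying the partner's shadow into `ℚ^{Hom(T,ℂ)}` therefore forces INTERACTION at every large even index

COR-CM (cell `pub-hodgecm2`, binder seat `b16` gen 69, count-neutral claim ROW SPACES OVER THE COMMUTANT ∕ THE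
INDEX-SCALING LAW, file Q6 — CM fields; theorems only, no definition, no named fact, no `sorry`).  NEW as stated, hence
under `Summits/`.  HONEST FRAMING: finite combinatorics of CM types (gen 68's surjectivity of the shadow) and linear
algebra of shadow-coefficient spaces; consequences for `dim MT(A₀ × A₁)` only; `HC_CM` is neither used nor asserted.

SETTING (gen 68 P2, this generation's S1/Q3).  `T ⊆ K_{i₀}` a subfield WITHOUT REAL PLACES containing the trace of the
partner (TR); `MC₁ = span{g ↦ u₁(g∘x)}`; `S(w) = span{g ↦ w(g∘y)}` for a weight `w` on `Hom(T, ℂ)`; the defect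
`dim Hg(A₀)+dim Hg(A₁)−dim Hg(A₀×A₁) = dim(S(w₀) ∩ MC₁)` for the shadow `w₀` of `Φ₀` (P2).

* §1 `exists_nat_forall_mul_eq_two_mul_int`: a rational weight has an EVEN common denominator `N` (`N·w ∈ 2ℤ^Y`);
  **`exists_cmType_shadow_eq_nat_mul`**: an ODD rational weight `w` with `N·w = 2z`, `|z| ≤ e`, is realised as
  `N·w =` the shadow of a CM type of every CM field `K₀ ⊇ T` with `[K₀:T] = 2e` (fibre counts `z + e`).
* §2 **`exists_cmFamilyRank_lt_of_shadowCoeff_inf_ne_bot`**: if `S(w) ∩ MC₁ ≠ 0` for such a `w`, some CM type `Φ₀` of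
  `K_{i₀}` INTERACTS with `Φ₁`: `cmFamilyRank + 1 < cmTypeRank Φ₀ + cmTypeRank Φ₁` (`S(N·w) = S(w)`, S1).  Rational
  solutions of the interaction equations are as good as integral ones — at EVEN index `≥ N·max|w|`.
* §3 **`exists_cmFamilyRank_lt_of_map`**: if a `ℚ`-linear `L : ℚ^{Hom(T₁,ℂ)} → ℚ^{Hom(T,ℂ)}` commuting with `Aut(ℂ)`
  along the orbit of the partner's shadow `w₁` (on any subfield `T₁ ⊆ K_{i₁}`) has `L w₁ = w` odd and non-zero, then
  `S(w) ≤ S(w₁) ≤ MC₁` (Q3 `span_shadowCoeff_le_of_map`) and §2 applies: EVERY field `K_{i₀} ⊇ T` (TR) of even index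
  `2e ≥` the bound carries a type interacting with `Φ₁`.  With Q4: over (IRR) pivots, «some index pair interacts» ⟺
  «an `Aut(ℂ)`-isomorphism `Anti(T₁) ≅ Anti(T₀)` exists» — and then all large EVEN indices interact, while odd indices are
  governed by the 2-adic position of the type cosets (census: the dyadic twins stay additive at odd × odd).

## References

* [Gordon1999HodgeAVSurvey] B. B. Gordon, *A survey of the Hodge conjecture for abelian varieties*, §3 Theorem (proof),
  7.5–7.7, 9.4.3.
* [Dodson1987] B. Dodson, J. Algebra 111 (1987), §1.1.
* [Shimura1998] G. Shimura, *Abelian Varieties with Complex Multiplication and Modular Functions*, §8.1, §18.1.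
-/

set_option autoImplicit false

noncomputable section

open scoped BigOperators Classical

open CategoryTheory CategoryTheory.Limits NumberField Module IntermediateField

namespace Summit.HodgeConjecture.CorCM

open Literature.NumberTheory.ComplexMultiplication
open Literature.AlgebraicGeometry.Motives (AbelianVariety CMType)
open Literature.AlgebraicGeometry.Motives.AbelianVariety
open Literature.AlgebraicGeometry.HodgeTheory
open Literature.AlgebraicGeometry.ComplexMultiplication (IsCMTypeRealisation)
open Literature.AlgebraicGeometry.Pohlmann1968

/-! ### §1 Even common denominators; realising `N·w` as a shadow -/

section Realise

/-- A rational weight on a finite set has an EVEN common denominator: `N·w(y) ∈ 2ℤ` for all `y`, `N ≠ 0`. [folklore] -/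
theorem exists_nat_forall_mul_eq_two_mul_int {Y : Type*} [Fintype Y] (w : Y → ℚ) :
    ∃ N : ℕ, N ≠ 0 ∧ ∀ y, ∃ z : ℤ, (N : ℚ) * w y = 2 * z := by
  refine ⟨2 * ∏ y, (w y).den, mul_ne_zero two_ne_zero (Finset.prod_ne_zero_iff.2 fun y _ => (w y).den_ne_zero),
    fun y => ⟨(∏ y' ∈ Finset.univ.erase y, ((w y').den : ℤ)) * (w y).num, ?_⟩⟩
  have hq : w y * (w y).den = (w y).num := Rat.mul_den_eq_num (w y)
  have hprod := Finset.prod_erase_mul (Finset.univ : Finset Y) (fun y' => ((w y').den : ℚ)) (Finset.mem_univ y)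
  push_cast
  rw [← hprod]
  linear_combination (2 * ∏ y' ∈ Finset.univ.erase y, ((w y').den : ℚ)) * hq

variable {K₀ : Type} [Field K₀] [NumberField K₀] [IsCMField K₀] {T : Type} [Field T] [NumberField T] [Algebra T K₀]

/-- **REALISING `N·w`**: `T` without real places, `K₀ ⊇ T` a CM field with `[K₀:T] = 2e`; an ODD rational weight `w` on
`Hom(T, ℂ)` with `N·w = 2z`, `|z(y)| ≤ e` ⟹ some CM type of `K₀` has shadow `N·w` on `T` (fibre counts `z(y) + e`;
gen 68's surjectivity of the shadow). [cite: Gordon1999HodgeAVSurvey, 9.4.3] [cite: Dodson1987, §1.1] -/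
theorem exists_cmType_shadow_eq_nat_mul [IsTotallyComplex T] (w : (T →+* ℂ) → ℚ)
    (hodd : ∀ y, w ((starRingAut : ℂ ≃+* ℂ) • y) = -w y) (N : ℕ) (z : (T →+* ℂ) → ℤ)
    (hz : ∀ y, (N : ℚ) * w y = 2 * z y) {e : ℕ} (he : Module.finrank T K₀ = 2 * e) (hB : ∀ y, |z y| ≤ e) :
    ∃ Φ₀ : CMType K₀, ∀ y : T →+* ℂ,
      ∑ t ∈ Finset.univ.filter (fun t : K₀ →+* ℂ => t.comp (algebraMap T K₀) = y), antiVec Φ₀.1 (1 : ℂ ≃+* ℂ) t =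
        (N : ℚ) * w y := by
  -- `z(ȳ) = −z(y)`
  have hzodd : ∀ y, z ((starRingAut : ℂ ≃+* ℂ) • y) = -z y := fun y => by
    have h1 := hz ((starRingAut : ℂ ≃+* ℂ) • y)
    rw [hodd, mul_neg, hz y] at h1
    have h2 : ((z ((starRingAut : ℂ ≃+* ℂ) • y) : ℚ)) = -z y := by linarith
    exact_mod_cast h2
  -- the fibre counts `k(y) = z(y) + e`
  have hk : ∀ y, ((Int.toNat (z y + e) : ℕ) : ℤ) = z y + e := fun y => by
    rw [Int.toNat_of_nonneg]
    have := abs_le.1 (hB y)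
    omega
  obtain ⟨Φ₀, hΦ₀⟩ := exists_cmType_forall_shadow_eq (K₀ := K₀) (fun y => Int.toNat (z y + e)) fun y => by
    have h1 := hk y
    have h2 := hk ((starRingAut : ℂ ≃+* ℂ) • y)
    zify
    rw [h1, h2, hzodd, he]
    push_cast
    ring
  refine ⟨Φ₀, fun y => ?_⟩
  rw [hΦ₀ y, hz y, he]
  have h1 : ((Int.toNat (z y + e) : ℕ) : ℚ) = (z y : ℚ) + e := by exact_mod_cast hk y
  rw [h1]
  push_cast
  ring

end Realise

/-! ### §2 A rational witness forces interaction at even index -/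

section Witness

variable {I : Type} [Fintype I] {K : I → Type} [∀ i, Field (K i)] [∀ i, NumberField (K i)] [∀ i, IsCMField (K i)]
  {T : Type} [Field T] [NumberField T]

/-- **A RATIONAL WITNESS IS REALISED**: `T ⊆ K_{i₀}` without real places containing the trace (TR), `[K_{i₀}:T] = 2e`; an
odd rational weight `w` on `Hom(T,ℂ)` with `N·w = 2z`, `|z| ≤ e`, `N ≠ 0`, whose coefficient space MEETS the partner's,
`S(w) ∩ MC₁ ≠ 0`.  Then some CM type `Φ₀` of `K_{i₀}` INTERACTS with `Φ₁`:
`cmFamilyRank + 1 < cmTypeRank Φ₀ + cmTypeRank Φ₁`, i.e. `dim Hg(A₀ × A₁) < dim Hg(A₀) + dim Hg(A₁)`.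
[cite: Gordon1999HodgeAVSurvey, §3 Theorem, 7.5–7.7 and 9.4.3] -/
theorem exists_cmFamilyRank_lt_of_shadowCoeff_inf_ne_bot {i₀ i₁ : I} (h01 : i₀ ≠ i₁) (hI : ∀ l, l = i₀ ∨ l = i₁)
    (Φ : ∀ i, CMType (K i)) [Algebra T (K i₀)] [IsTotallyComplex T]
    (htr : ∀ (a : K i₀ →+* ℂ) (k : K i₀), a k ∈ normalClosure ℚ (K i₁) ℂ → k ∈ Set.range (algebraMap T (K i₀)))
    (w : (T →+* ℂ) → ℚ) (hodd : ∀ y, w ((starRingAut : ℂ ≃+* ℂ) • y) = -w y) {N : ℕ} (hN : N ≠ 0)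
    (z : (T →+* ℂ) → ℤ) (hz : ∀ y, (N : ℚ) * w y = 2 * z y) {e : ℕ} (he : Module.finrank T (K i₀) = 2 * e)
    (hB : ∀ y, |z y| ≤ e)
    (hmeet : Submodule.span ℚ (Set.range fun y : T →+* ℂ => fun g : ℂ ≃+* ℂ => w (g • y)) ⊓
      Submodule.span ℚ (Set.range fun x : K i₁ →+* ℂ => fun g : ℂ ≃+* ℂ => antiVec (Φ i₁).1 g x) ≠ ⊥) :
    ∃ Φ₀ : CMType (K i₀),
      CMAlgebra.cmFamilyRank (Function.update Φ i₀ Φ₀) + 1 < cmTypeRank Φ₀ + cmTypeRank (Φ i₁) := by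
  obtain ⟨Φ₀, hΦ₀⟩ := exists_cmType_shadow_eq_nat_mul (K₀ := K i₀) w hodd N z hz he hB
  refine ⟨Φ₀, ?_⟩
  have h := cmTypeRank_add_cmTypeRank_eq_cmFamilyRank_add_one_add_finrank_shadow_inf h01 hI (Function.update Φ i₀ Φ₀) htr
  rw [Function.update_self, Function.update_of_ne h01.symm] at h
  have hS : (fun y : T →+* ℂ => fun g : ℂ ≃+* ℂ =>
      ∑ t ∈ Finset.univ.filter (fun t : K i₀ →+* ℂ => t.comp (algebraMap T (K i₀)) = g • y),
        antiVec Φ₀.1 (1 : ℂ ≃+* ℂ) t) = fun y : T →+* ℂ => (N : ℚ) • fun g : ℂ ≃+* ℂ => w (g • y) := by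
    funext y
    funext g
    rw [Pi.smul_apply, smul_eq_mul]
    exact hΦ₀ (g • y)
  have hN' : (N : ℚ) ≠ 0 := by exact_mod_cast hN
  rw [hS, span_range_smul_eq_of_ne_zero _ hN'] at h
  haveI : FiniteDimensional ℚ (Submodule.span ℚ (Set.range fun y : T →+* ℂ => fun g : ℂ ≃+* ℂ => w (g • y))) :=
    FiniteDimensional.span_of_finite ℚ (Set.finite_range _)
  have hpos : Module.finrank ℚ (Submodule.span ℚ (Set.range fun y : T →+* ℂ => fun g : ℂ ≃+* ℂ => w (g • y)) ⊓
      Submodule.span ℚ (Set.range fun x : K i₁ →+* ℂ => fun g : ℂ ≃+* ℂ => antiVec (Φ i₁).1 g x) :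
        Submodule ℚ ((ℂ ≃+* ℂ) → ℚ)) ≠ 0 := fun h0 => hmeet (Submodule.finrank_eq_zero.1 h0)
  omega

end Witness

/-! ### §3 An equivariant map carrying the partner's shadow gives a witness -/

section Map

variable {I : Type} [Fintype I] {K : I → Type} [∀ i, Field (K i)] [∀ i, NumberField (K i)] [∀ i, IsCMField (K i)]
  {T : Type} [Field T] [NumberField T] {T₁ : Type} [Field T₁] [NumberField T₁]

/-- **AN EQUIVARIANT MAP CARRYING THE PARTNER'S SHADOW FORCES INTERACTION AT LARGE EVEN INDEX**: `T ⊆ K_{i₀}` without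
real places, (TR), `[K_{i₀}:T] = 2e`; any subfield `T₁ ⊆ K_{i₁}` with the shadow `w₁` of `Φ₁` on it; a `ℚ`-linear
`L : ℚ^{Hom(T₁,ℂ)} → ℚ^{Hom(T,ℂ)}` commuting with `Aut(ℂ)` along the orbit of `w₁`, with `L w₁ = w` ODD and NON-ZERO,
`N·w = 2z`, `|z| ≤ e`, `N ≠ 0`.  Then some CM type of `K_{i₀}` interacts with `Φ₁`.  (With Q3/Q4: over (IRR) pivots an
`Aut(ℂ)`-isomorphism `Anti(T₁) ≅ Anti(T)` exists iff SOME index pair interacts, and then every large even index does.)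
[cite: Gordon1999HodgeAVSurvey, §3 Theorem, 7.5–7.7 and 9.4.3] -/
theorem exists_cmFamilyRank_lt_of_map {i₀ i₁ : I} (h01 : i₀ ≠ i₁) (hI : ∀ l, l = i₀ ∨ l = i₁)
    (Φ : ∀ i, CMType (K i)) [Algebra T (K i₀)] [Algebra T₁ (K i₁)] [IsTotallyComplex T]
    (htr : ∀ (a : K i₀ →+* ℂ) (k : K i₀), a k ∈ normalClosure ℚ (K i₁) ℂ → k ∈ Set.range (algebraMap T (K i₀)))
    (L : ((T₁ →+* ℂ) → ℚ) →ₗ[ℚ] ((T →+* ℂ) → ℚ))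
    (hL : ∀ k : ℂ ≃+* ℂ,
      L (fun y => ∑ t ∈ Finset.univ.filter (fun t : K i₁ →+* ℂ => t.comp (algebraMap T₁ (K i₁)) = k • y),
          antiVec (Φ i₁).1 (1 : ℂ ≃+* ℂ) t) =
        fun y => L (fun y' => ∑ t ∈ Finset.univ.filter (fun t : K i₁ →+* ℂ => t.comp (algebraMap T₁ (K i₁)) = y'),
          antiVec (Φ i₁).1 (1 : ℂ ≃+* ℂ) t) (k • y))
    {w : (T →+* ℂ) → ℚ}
    (hLw : L (fun y' => ∑ t ∈ Finset.univ.filter (fun t : K i₁ →+* ℂ => t.comp (algebraMap T₁ (K i₁)) = y'),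
      antiVec (Φ i₁).1 (1 : ℂ ≃+* ℂ) t) = w)
    (hw0 : w ≠ 0) (hodd : ∀ y, w ((starRingAut : ℂ ≃+* ℂ) • y) = -w y) {N : ℕ} (hN : N ≠ 0)
    (z : (T →+* ℂ) → ℤ) (hz : ∀ y, (N : ℚ) * w y = 2 * z y) {e : ℕ} (he : Module.finrank T (K i₀) = 2 * e)
    (hB : ∀ y, |z y| ≤ e) :
    ∃ Φ₀ : CMType (K i₀),
      CMAlgebra.cmFamilyRank (Function.update Φ i₀ Φ₀) + 1 < cmTypeRank Φ₀ + cmTypeRank (Φ i₁) := by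
  refine exists_cmFamilyRank_lt_of_shadowCoeff_inf_ne_bot h01 hI Φ htr w hodd hN z hz he hB ?_
  -- `S(w) ≤ S(w₁) ≤ MC₁`, and `S(w) ≠ 0`
  have hle₁ : Submodule.span ℚ (Set.range fun y : T →+* ℂ => fun g : ℂ ≃+* ℂ => w (g • y)) ≤
      Submodule.span ℚ (Set.range fun y : T₁ →+* ℂ => fun g : ℂ ≃+* ℂ =>
        (fun y' => ∑ t ∈ Finset.univ.filter (fun t : K i₁ →+* ℂ => t.comp (algebraMap T₁ (K i₁)) = y'),
          antiVec (Φ i₁).1 (1 : ℂ ≃+* ℂ) t) (g • y)) :=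
    IrrOdd.span_shadowCoeff_le_of_map (G := ℂ ≃+* ℂ) L (w₀ := w)
      (w₁ := fun y' : T₁ →+* ℂ => ∑ t ∈ Finset.univ.filter (fun t : K i₁ →+* ℂ => t.comp (algebraMap T₁ (K i₁)) = y'),
        antiVec (Φ i₁).1 (1 : ℂ ≃+* ℂ) t) hL hLw
  have hle₂ : Submodule.span ℚ (Set.range fun y : T₁ →+* ℂ => fun g : ℂ ≃+* ℂ =>
        (fun y' => ∑ t ∈ Finset.univ.filter (fun t : K i₁ →+* ℂ => t.comp (algebraMap T₁ (K i₁)) = y'),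
          antiVec (Φ i₁).1 (1 : ℂ ≃+* ℂ) t) (g • y)) ≤
      Submodule.span ℚ (Set.range fun x : K i₁ →+* ℂ => fun g : ℂ ≃+* ℂ => antiVec (Φ i₁).1 g x) := by
    beta_reduce
    rw [← IrrOdd.span_fibreSum_eq_span_shadowCoeff (G := ℂ ≃+* ℂ) (Φ i₁).1
      (fun t : K i₁ →+* ℂ => t.comp (algebraMap T₁ (K i₁))) (fun _ _ => rfl)]
    exact IrrOdd.span_fibreSum_le_span_coeff (G := ℂ ≃+* ℂ) (Φ i₁).1 _
  intro hbot
  apply hw0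
  rw [← IrrOdd.span_shadowCoeff_eq_bot_iff (G := ℂ ≃+* ℂ) w]
  exact le_bot_iff.1 ((le_inf le_rfl (hle₁.trans hle₂)).trans hbot.le)

end Map

end Summit.HodgeConjecture.CorCM

end
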